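import Mathlib
import HarnessLib
import Summits.Ventures.LatticeQCDFlow.Scoring.SplitChainTourTheorem
import Summits.Ventures.LatticeQCDFlow.Scoring.SplitChainTourMoments
import Summits.Ventures.LatticeQCDFlow.Scoring.RegenerativeTourCement

/-!
# Tours of the split chain, VII: the tour sequence IS an i.i.d. sequence — joint independence
# (`iIndepFun`) and identical distribution (`IdentDistrib`) of the tour functionals as random
# elements, from any initial law

HONEST FRAMING: exact (Metropolis-corrected) sampling algorithms for lattice gauge theory;
figures of merit are autocorrelation/cost numbers at stated couplings and volumes; no
continuum-physics claim.

Venture `LatticeQCDFlow` (cell pub-lqcd), topic `Scoring`; FANOUT row 8 (`s0-cpn-nemc`, GEN-18).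
NEW WORK of the cell, not a published result; no definition is introduced.  Notation of
`Scoring/SplitChainTours.lean`: head count `K_t`, tour `i = {t : K_t = i}`, tour sums
`S^g_i(x̂) = ∑' u, 1{K_u = i} g(X_u)` of a function `g` of the state, tour length `N_i = S^1_i`; `P̂`
the split chain of `κ(x, ·) ≥ ε ν` (`0 < ε < 1`) from ANY initial law, `P̂_ν̂` the fresh one.
`Scoring/SplitChainTourTheorem.lean` proved the regenerative structure in FUNCTIONAL form (one tour
at a time, weighted by a bounded functional of the past) and explicitly did NOT claim joint
independence of the tour sequence as one random element.  This file closes that gap in Mathlib's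
own vocabulary (this file: the analytic step; `Scoring/SplitChainTourIID.lean`: the packaging): for
merely MEASURABLE `g₁, g₂ : Ω → ℝ` (no boundedness needed), the sequence of tour pairs `T_i := (S^{g₁}_{i+1}, S^{g₂}_{i+1})`, `i = 0, 1, 2, …` (tours `1, 2, 3, …`) is
`ProbabilityTheory.iIndepFun` under `P̂`, and each `T_i` is `ProbabilityTheory.IdentDistrib` with
the first-tour pair `(S^{g₁}_0, S^{g₂}_0)` under `P̂_ν̂` (hence with `T_0`).  This is the input
Mathlib's strong law (`ProbabilityTheory.strong_law_ae`) and central limit theorem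
(`ProbabilityTheory.tendstoInDistribution_inv_sqrt_mul_sum_sub`) consume; the regenerative CLT is
`Scoring/RegenerativeCLT.lean`.  Proof: the finite-dimensional product formula
`P̂(T_0 ∈ B_0, …, T_n ∈ B_n) = P̂(T_0 ∈ B_0, …, T_{n−1} ∈ B_{n−1}) · P̂_ν̂((S^{g₁}_0, S^{g₂}_0) ∈ B_n)`
is the tour theorem at the `(n+1)`-th regeneration with the past weight
`1{T_0 ∈ B_0, …, T_{n−1} ∈ B_{n−1}} ∘ cement_t` (a functional of the path up to `t` that agrees
with the un-cemented indicator at the regeneration time, `Scoring/RegenerativeTourCement.lean`) and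
the future functional `1{(S^{g₁}_0, S^{g₂}_0) ∈ B_n}` transported to the tour start; induction on
`n` and the extension from initial segments to arbitrary finite index sets give `iIndepFun`.
Printed counterpart NAMED ONLY: the regenerative decomposition of a split chain into i.i.d. tours
(Athreya–Ney 1978; Nummelin 1978; Meyn–Tweedie 1993 Thm 17.3.1; Mykland–Tierney–Yu 1995 §2) —
nothing is cited as a fact.

## Content (`0 < ε < 1`, any initial law `μs`, `g₁ g₂ : Ω → ℝ` measurable,
## `T_i = (S^{g₁}_{i+1}, S^{g₂}_{i+1})`, `T⁰ = (S^{g₁}_0, S^{g₂}_0)`)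

* `measurable_tourPair` — `T_i` (and `T⁰`) are measurable;
* **`splitChain_tourPairs_factorisation`** — for measurable `B_0, …, B_n ⊆ ℝ × ℝ`:
  `P̂(⋂_{i<n+1} {T_i ∈ B_i}) = P̂(⋂_{i<n} {T_i ∈ B_i}) · P̂_ν̂(T⁰ ∈ B_n)` (real form);
* **`splitChain_tourPair_law`** — `P̂(T_n ∈ B) = P̂_ν̂(T⁰ ∈ B)` for every measurable `B` (no
  `Λ(0,0) = 0` proviso: tours end almost surely).

The packaging as `iIndepFun` / `IdentDistrib` (product formula over initial segments, extension to
arbitrary finite index sets) is `Scoring/SplitChainTourIID.lean`.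

NOT CLAIMED: functionals of a tour that look at the state AFTER the tour's last update (two-point
`ψ(x̂_u, x̂_{u+1})` depending on `x̂_{u+1}`; those are one-dependent, not independent); tour `0`
(its law depends on the initial law); any `ε` of a concrete sampler.
-/

noncomputable section

namespace Summit.Ventures.LatticeQCDFlow.Scoring

open MeasureTheory ProbabilityTheory Filter Finset Preorder Literature.Probability.MarkovChains
open scoped ENNReal

/-! ### Measurability of the tour pairs -/

section Measurability

variable {Ω : Type*} [MeasurableSpace Ω]

/-- The tour pair `(S^{g₁}_a, S^{g₂}_a)` is a measurable function of the path. -/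
theorem measurable_tourPair {g₁ g₂ : Ω → ℝ} (hg₁ : Measurable g₁) (hg₂ : Measurable g₂) (a : ℕ) :
    Measurable fun x : ℕ → Ω × Bool =>
      ((∑' u, (if (∑ s ∈ Finset.range u, (if (x (s + 1)).2 then (1 : ℕ) else 0)) = a
          then (1 : ℝ) else 0) * g₁ (x u).1),
        (∑' u, (if (∑ s ∈ Finset.range u, (if (x (s + 1)).2 then (1 : ℕ) else 0)) = a
          then (1 : ℝ) else 0) * g₂ (x u).1)) :=
  (measurable_tourSum (Ω := Ω) (ψ := fun p _ => g₁ p.1)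
      (hg₁.comp (measurable_fst.comp measurable_fst)) a).prodMk
    (measurable_tourSum (Ω := Ω) (ψ := fun p _ => g₂ p.1)
      (hg₂.comp (measurable_fst.comp measurable_fst)) a)

end Measurability

/-! ### The product formula for the tour pairs -/

section Independence

variable {Ω : Type*} [MeasurableSpace Ω]
  {κ : Kernel Ω Ω} [IsMarkovKernel κ] {ν : Measure Ω} [IsProbabilityMeasure ν] {ε : ℝ≥0∞}
  {hmin : ∀ x {B : Set Ω}, MeasurableSet B → ε * ν B ≤ κ x B}
  (κs : Kernel (Ω × Bool) (Ω × Bool)) [IsMarkovKernel κs]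
  (μs : Measure (Ω × Bool)) [IsProbabilityMeasure μs]

/-- **THE FACTORISATION STEP.**  `0 < ε < 1`, any initial law, `g₁, g₂` measurable, `B_i ⊆ ℝ × ℝ`
measurable.  Then
`P̂(⋂_{i<n+1} {T_i ∈ B_i}) = P̂(⋂_{i<n} {T_i ∈ B_i}) · P̂_ν̂((S^{g₁}_0, S^{g₂}_0) ∈ B_n)`:
conditionally on the tours `1, …, n`, tour `n + 1` has the law of the first tour of a fresh run. -/
theorem splitChain_tourPairs_factorisation (hε0 : 0 < ε) (hε : ε < 1)
    (hκs : ∀ p, κs p = (ε • ν).map (fun y : Ω => (y, true))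
      + ((1 - ε) • Doeblin.residualKernel κ ν ε hmin p.1).map (fun y : Ω => (y, false)))
    {g₁ g₂ : Ω → ℝ} (hg₁ : Measurable g₁) (hg₂ : Measurable g₂)
    {B : ℕ → Set (ℝ × ℝ)} (hB : ∀ i, MeasurableSet (B i)) (n : ℕ) :
    (Kernel.trajMeasure (X := fun _ : ℕ => Ω × Bool) μs
        (fun m : ℕ => κs.comap (fun h : (i : ↥(Finset.Iic m)) → Ω × Bool =>
          h ⟨m, Finset.mem_Iic.2 le_rfl⟩) (measurable_pi_apply _))).real
      (⋂ i ∈ Finset.range (n + 1), (fun x : ℕ → Ω × Bool =>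
        ((∑' u, (if (∑ s ∈ Finset.range u, (if (x (s + 1)).2 then (1 : ℕ) else 0)) = i + 1
            then (1 : ℝ) else 0) * g₁ (x u).1),
          (∑' u, (if (∑ s ∈ Finset.range u, (if (x (s + 1)).2 then (1 : ℕ) else 0)) = i + 1
            then (1 : ℝ) else 0) * g₂ (x u).1))) ⁻¹' B i)
      = (Kernel.trajMeasure (X := fun _ : ℕ => Ω × Bool) μs
          (fun m : ℕ => κs.comap (fun h : (i : ↥(Finset.Iic m)) → Ω × Bool =>
            h ⟨m, Finset.mem_Iic.2 le_rfl⟩) (measurable_pi_apply _))).real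
        (⋂ i ∈ Finset.range n, (fun x : ℕ → Ω × Bool =>
          ((∑' u, (if (∑ s ∈ Finset.range u, (if (x (s + 1)).2 then (1 : ℕ) else 0)) = i + 1
              then (1 : ℝ) else 0) * g₁ (x u).1),
            (∑' u, (if (∑ s ∈ Finset.range u, (if (x (s + 1)).2 then (1 : ℕ) else 0)) = i + 1
              then (1 : ℝ) else 0) * g₂ (x u).1))) ⁻¹' B i)
        * (Kernel.trajMeasure (X := fun _ : ℕ => Ω × Bool) (ν.map (fun y : Ω => (y, true)))
          (fun m : ℕ => κs.comap (fun h : (i : ↥(Finset.Iic m)) → Ω × Bool =>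
            h ⟨m, Finset.mem_Iic.2 le_rfl⟩) (measurable_pi_apply _))).real
        ((fun y : ℕ → Ω × Bool =>
          ((∑' u, (if (∑ s ∈ Finset.range u, (if (y (s + 1)).2 then (1 : ℕ) else 0)) = 0
              then (1 : ℝ) else 0) * g₁ (y u).1),
            (∑' u, (if (∑ s ∈ Finset.range u, (if (y (s + 1)).2 then (1 : ℕ) else 0)) = 0
              then (1 : ℝ) else 0) * g₂ (y u).1))) ⁻¹' B n) := by
  haveI hνt : IsProbabilityMeasure (ν.map (fun y : Ω => (y, true))) :=
    Measure.isProbabilityMeasure_map (measurable_tagCoin true).aemeasurable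
  set P := Kernel.trajMeasure (X := fun _ : ℕ => Ω × Bool) μs
      (fun m : ℕ => κs.comap (fun h : (i : ↥(Finset.Iic m)) → Ω × Bool =>
        h ⟨m, Finset.mem_Iic.2 le_rfl⟩) (measurable_pi_apply _)) with hP
  set Pν := Kernel.trajMeasure (X := fun _ : ℕ => Ω × Bool) (ν.map (fun y : Ω => (y, true)))
      (fun m : ℕ => κs.comap (fun h : (i : ↥(Finset.Iic m)) → Ω × Bool =>
        h ⟨m, Finset.mem_Iic.2 le_rfl⟩) (measurable_pi_apply _)) with hPν
  -- the tour pairs `T a` (tour `a`) as named functions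
  set T : ℕ → (ℕ → Ω × Bool) → ℝ × ℝ := fun a x =>
      ((∑' u, (if (∑ s ∈ Finset.range u, (if (x (s + 1)).2 then (1 : ℕ) else 0)) = a
          then (1 : ℝ) else 0) * g₁ (x u).1),
        (∑' u, (if (∑ s ∈ Finset.range u, (if (x (s + 1)).2 then (1 : ℕ) else 0)) = a
          then (1 : ℝ) else 0) * g₂ (x u).1)) with hT
  have hTm : ∀ a, Measurable (T a) := fun a => measurable_tourPair hg₁ hg₂ a
  -- the past event `A = ⋂_{i<n} {T (i+1) ∈ B i}` and its indicator `Φ`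
  set A : Set (ℕ → Ω × Bool) := ⋂ i ∈ Finset.range n, (T (i + 1)) ⁻¹' B i with hA
  have hAm : MeasurableSet A :=
    Finset.measurableSet_biInter _ fun i _ => hTm (i + 1) (hB i)
  have hEm : MeasurableSet ((T (n + 1)) ⁻¹' B n) := hTm (n + 1) (hB n)
  -- the set in the statement is `A ∩ {T (n+1) ∈ B n}`
  have hsplit : (⋂ i ∈ Finset.range (n + 1), (T (i + 1)) ⁻¹' B i) = A ∩ (T (n + 1)) ⁻¹' B n := by
    ext x
    simp only [hA, Set.mem_iInter, Set.mem_inter_iff, Finset.mem_range]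
    constructor
    · intro h
      exact ⟨fun i hi => h i (by omega), h n (by omega)⟩
    · rintro ⟨h1, h2⟩ i hi
      rcases Nat.lt_succ_iff_lt_or_eq.1 hi with hi' | rfl
      · exact h1 i hi'
      · exact h2
  show P.real (⋂ i ∈ Finset.range (n + 1), (T (i + 1)) ⁻¹' B i)
    = P.real A * Pν.real ((T 0) ⁻¹' B n)
  rw [hsplit]
  -- the past weight `Φ ∘ cement_t` and the future functional `H = 1{T 0 ∈ B n}`
  set Φ : (ℕ → Ω × Bool) → ℝ := A.indicator 1 with hΦ
  have hΦm : Measurable Φ := measurable_one.indicator hAm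
  have hΦ01 : ∀ x, Φ x = 0 ∨ Φ x = 1 := fun x => by
    by_cases hx : x ∈ A
    · exact Or.inr (by simp [hΦ, hx])
    · exact Or.inl (by simp [hΦ, hx])
  set H : (ℕ → Ω × Bool) → ℝ := ((T 0) ⁻¹' B n).indicator 1 with hH
  have hHm : Measurable H := measurable_one.indicator (hTm 0 (hB n))
  have hH01 : ∀ y, H y = 0 ∨ H y = 1 := fun y => by
    by_cases hy : y ∈ (T 0) ⁻¹' B n
    · exact Or.inr (by simp [hH, hy])
    · exact Or.inl (by simp [hH, hy])
  have hHi : Integrable H Pν :=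
    integrable_of_bounded Pν hHm (C := 1) fun y => by
      rcases hH01 y with h | h <;> simp [h]
  have hGm := fun t : ℕ => hΦm.comp (measurable_cement (Ω := Ω) t)
  have hGd := fun t : ℕ => dependsOn_comp_cement Φ t
  have hGC : ∀ (t : ℕ) (x : ℕ → Ω × Bool),
      |(Φ ∘ (fun (x : ℕ → Ω × Bool) (m : ℕ) => if m ≤ t then x m else ((x t).1, true))) x| ≤ 1 := by
    intro t x
    simp only [Function.comp_apply]
    rcases hΦ01 (fun m : ℕ => if m ≤ t then x m else ((x t).1, true)) with h | h <;> simp [h]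
  have key := splitChain_tour_regeneration κs μs (κ := κ) (ν := ν) (hmin := hmin) hε hκs n hGm hGd
    hGC hHm hHi
  rw [← hP, ← hPν] at key
  simp only [Function.comp_apply] at key
  -- almost surely every tour starts
  have hae := splitChain_ae_tourStart κs μs (κ := κ) (ν := ν) (hmin := hmin) hε0 hε hκs
  rw [← hP] at hae
  -- pathwise: cementing at the start `t₀ + 1` of tour `n + 1` does not change `Φ`
  have hpast : ∀ (x : ℕ → Ω × Bool) (t₀ : ℕ),
      (∑ s ∈ Finset.range t₀, (if (x (s + 1)).2 then (1 : ℕ) else 0)) = n →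
      (x (t₀ + 1)).2 = true →
      Φ (fun m : ℕ => if m ≤ t₀ then x m else ((x t₀).1, true)) = Φ x := by
    intro x t₀ ht₀ hh₀
    have hTi : ∀ i ∈ Finset.range n,
        T (i + 1) (fun m : ℕ => if m ≤ t₀ then x m else ((x t₀).1, true)) = T (i + 1) x := by
      intro i hi
      have hi' : i + 1 ≤ n := Finset.mem_range.1 hi
      simp only [hT]
      rw [tourSum_cement g₁ x hi' ht₀ hh₀, tourSum_cement g₂ x hi' ht₀ hh₀]
    have hmem : (fun m : ℕ => if m ≤ t₀ then x m else ((x t₀).1, true)) ∈ A ↔ x ∈ A := by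
      simp only [hA, Set.mem_iInter, Set.mem_preimage]
      exact forall₂_congr fun i hi => by rw [hTi i hi]
    by_cases hx : x ∈ A
    · rw [hΦ, Set.indicator_of_mem hx, Set.indicator_of_mem (hmem.2 hx), Pi.one_apply,
        Pi.one_apply]
    · rw [hΦ, Set.indicator_of_notMem hx, Set.indicator_of_notMem (fun h => hx (hmem.1 h))]
  -- pathwise: the first-tour pair of the shifted path is the pair of tour `n + 1`
  have hfut : ∀ (x : ℕ → Ω × Bool) (t₀ : ℕ),
      (∑ s ∈ Finset.range t₀, (if (x (s + 1)).2 then (1 : ℕ) else 0)) = n →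
      (x (t₀ + 1)).2 = true →
      H (fun m => x (t₀ + 1 + m)) = ((T (n + 1)) ⁻¹' B n).indicator 1 x := by
    intro x t₀ ht₀ hh₀
    have hTn : T 0 (fun m => x (t₀ + 1 + m)) = T (n + 1) x := by
      simp only [hT]
      rw [tourSum_transport (fun p _ => g₁ p.1) x ht₀ hh₀,
        tourSum_transport (fun p _ => g₂ p.1) x ht₀ hh₀]
    have hmem : (fun m => x (t₀ + 1 + m)) ∈ (T 0) ⁻¹' B n ↔ x ∈ (T (n + 1)) ⁻¹' B n := by
      simp only [Set.mem_preimage, hTn]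
    by_cases hx : x ∈ (T (n + 1)) ⁻¹' B n
    · rw [hH, Set.indicator_of_mem hx, Set.indicator_of_mem (hmem.2 hx), Pi.one_apply,
        Pi.one_apply]
    · rw [hH, Set.indicator_of_notMem hx, Set.indicator_of_notMem (fun h => hx (hmem.1 h))]
  -- vanishing of the weights away from the tour start
  have hzero : ∀ (x : ℕ → Ω × Bool) (t₀ : ℕ),
      (∑ s ∈ Finset.range t₀, (if (x (s + 1)).2 then (1 : ℕ) else 0)) = n →
      (x (t₀ + 1)).2 = true → ∀ (a w : ℕ → ℝ) (t : ℕ), t ≠ t₀ →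
      a t * (if (∑ s ∈ Finset.range t, (if (x (s + 1)).2 then (1 : ℕ) else 0)) = n
        then (1 : ℝ) else 0) * (if (x (t + 1)).2 then (1 : ℝ) else 0) * w t = 0 := by
    intro x t₀ ht₀ hh₀ a w t hne
    by_cases h1 : (∑ s ∈ Finset.range t, (if (x (s + 1)).2 then (1 : ℕ) else 0)) = n
    · have h2 : ¬ (x (t + 1)).2 = true := fun h2 => hne (tourStart_unique x h1 h2 ht₀ hh₀)
      rw [if_neg h2, mul_zero, zero_mul]
    · rw [if_neg h1, mul_zero, zero_mul, zero_mul]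
  -- the two almost-sure identities
  have hid1 : ∀ᵐ x ∂P, (∑' t, Φ (fun m : ℕ => if m ≤ t then x m else ((x t).1, true))
        * (if (∑ s ∈ Finset.range t, (if (x (s + 1)).2 then (1 : ℕ) else 0)) = n
          then (1 : ℝ) else 0) * (if (x (t + 1)).2 then (1 : ℝ) else 0)
        * H (fun m => x (t + 1 + m)))
      = (A ∩ (T (n + 1)) ⁻¹' B n).indicator 1 x := by
    filter_upwards [hae] with x hx
    obtain ⟨t₀, ht₀, hh₀⟩ := hx n
    rw [tsum_eq_single t₀ (hzero x t₀ ht₀ hh₀ _ _), if_pos ht₀, if_pos hh₀, mul_one, mul_one,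
      hpast x t₀ ht₀ hh₀, hfut x t₀ ht₀ hh₀, Set.inter_indicator_one]
    rfl
  have hid2 : ∀ᵐ x ∂P, (∑' t, Φ (fun m : ℕ => if m ≤ t then x m else ((x t).1, true))
        * (if (∑ s ∈ Finset.range t, (if (x (s + 1)).2 then (1 : ℕ) else 0)) = n
          then (1 : ℝ) else 0) * (if (x (t + 1)).2 then (1 : ℝ) else 0))
      = Φ x := by
    filter_upwards [hae] with x hx
    obtain ⟨t₀, ht₀, hh₀⟩ := hx n
    have hz := fun t (ht : t ≠ t₀) => hzero x t₀ ht₀ hh₀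
      (fun t => Φ (fun m : ℕ => if m ≤ t then x m else ((x t).1, true))) (fun _ => 1) t ht
    simp only [mul_one] at hz
    rw [tsum_eq_single t₀ hz, if_pos ht₀, if_pos hh₀, mul_one, mul_one, hpast x t₀ ht₀ hh₀]
  -- assemble
  rw [← integral_indicator_one (hAm.inter hEm), ← integral_congr_ae hid1, key,
    integral_congr_ae hid2, hΦ, integral_indicator_one hAm, hH, integral_indicator_one (hTm 0 (hB n))]

/-- **THE LAW OF EVERY LATER TOUR IS THE FRESH FIRST-TOUR LAW** (no `Λ(0,0) = 0` proviso):
`P̂(T_n ∈ S) = P̂_ν̂(T⁰ ∈ S)` for every measurable `S ⊆ ℝ × ℝ`. -/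
theorem splitChain_tourPair_law (hε0 : 0 < ε) (hε : ε < 1)
    (hκs : ∀ p, κs p = (ε • ν).map (fun y : Ω => (y, true))
      + ((1 - ε) • Doeblin.residualKernel κ ν ε hmin p.1).map (fun y : Ω => (y, false)))
    {g₁ g₂ : Ω → ℝ} (hg₁ : Measurable g₁) (hg₂ : Measurable g₂)
    {S : Set (ℝ × ℝ)} (hS : MeasurableSet S) (n : ℕ) :
    (Kernel.trajMeasure (X := fun _ : ℕ => Ω × Bool) μs
        (fun m : ℕ => κs.comap (fun h : (i : ↥(Finset.Iic m)) → Ω × Bool =>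
          h ⟨m, Finset.mem_Iic.2 le_rfl⟩) (measurable_pi_apply _))).real
      ((fun x : ℕ → Ω × Bool =>
        ((∑' u, (if (∑ s ∈ Finset.range u, (if (x (s + 1)).2 then (1 : ℕ) else 0)) = n + 1
            then (1 : ℝ) else 0) * g₁ (x u).1),
          (∑' u, (if (∑ s ∈ Finset.range u, (if (x (s + 1)).2 then (1 : ℕ) else 0)) = n + 1
            then (1 : ℝ) else 0) * g₂ (x u).1))) ⁻¹' S)
      = (Kernel.trajMeasure (X := fun _ : ℕ => Ω × Bool) (ν.map (fun y : Ω => (y, true)))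
          (fun m : ℕ => κs.comap (fun h : (i : ↥(Finset.Iic m)) → Ω × Bool =>
            h ⟨m, Finset.mem_Iic.2 le_rfl⟩) (measurable_pi_apply _))).real
        ((fun y : ℕ → Ω × Bool =>
          ((∑' u, (if (∑ s ∈ Finset.range u, (if (y (s + 1)).2 then (1 : ℕ) else 0)) = 0
              then (1 : ℝ) else 0) * g₁ (y u).1),
            (∑' u, (if (∑ s ∈ Finset.range u, (if (y (s + 1)).2 then (1 : ℕ) else 0)) = 0
              then (1 : ℝ) else 0) * g₂ (y u).1))) ⁻¹' S) := by
  set T : ℕ → (ℕ → Ω × Bool) → ℝ × ℝ := fun a x =>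
      ((∑' u, (if (∑ s ∈ Finset.range u, (if (x (s + 1)).2 then (1 : ℕ) else 0)) = a
          then (1 : ℝ) else 0) * g₁ (x u).1),
        (∑' u, (if (∑ s ∈ Finset.range u, (if (x (s + 1)).2 then (1 : ℕ) else 0)) = a
          then (1 : ℝ) else 0) * g₂ (x u).1)) with hT
  -- the family `B i = S` at `i = n`, `univ` elsewhere
  set B : ℕ → Set (ℝ × ℝ) := fun i => if i = n then S else Set.univ with hBdef
  have hB : ∀ i, MeasurableSet (B i) := fun i => by
    by_cases hi : i = n
    · simp only [hBdef, hi, if_true]; exact hS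
    · simp only [hBdef, hi, if_false]; exact MeasurableSet.univ
  have h := splitChain_tourPairs_factorisation κs μs (κ := κ) (ν := ν) (hmin := hmin) hε0 hε hκs
    hg₁ hg₂ hB n
  have h1 : (⋂ i ∈ Finset.range (n + 1), (T (i + 1)) ⁻¹' B i) = (T (n + 1)) ⁻¹' S := by
    ext x
    simp only [Set.mem_iInter, Set.mem_preimage, Finset.mem_range, hBdef]
    constructor
    · intro hx
      have := hx n (Nat.lt_succ_self n)
      rwa [if_pos rfl] at this
    · intro hx i _
      by_cases hi : i = n
      · rw [if_pos hi]; subst hi; exact hx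
      · rw [if_neg hi]; exact Set.mem_univ _
  have h2 : (⋂ i ∈ Finset.range n, (T (i + 1)) ⁻¹' B i) = Set.univ := by
    refine Set.eq_univ_of_forall fun x => ?_
    simp only [Set.mem_iInter, Set.mem_preimage, Finset.mem_range, hBdef]
    intro i hi
    rw [if_neg (Nat.ne_of_lt hi)]
    exact Set.mem_univ _
  have h3 : B n = S := if_pos rfl
  change (Kernel.trajMeasure (X := fun _ : ℕ => Ω × Bool) μs
      (fun m : ℕ => κs.comap (fun h : (i : ↥(Finset.Iic m)) → Ω × Bool =>
        h ⟨m, Finset.mem_Iic.2 le_rfl⟩) (measurable_pi_apply _))).real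
      (⋂ i ∈ Finset.range (n + 1), (T (i + 1)) ⁻¹' B i) = _ at h
  rw [h1, h2, probReal_univ, one_mul, h3] at h
  exact h

end Independence

end Summit.Ventures.LatticeQCDFlow.Scoring

end
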